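import Summits.BirchSwinnertonDyer.Rank1Residual.GaloisImage.SmallImageKuriharaInvariants
import Summits.BirchSwinnertonDyer.Rank1Residual.Additive.X4SharpThreeKimShaLength
import Literature.NumberTheory.EllipticCurves.Rank1Residual.Typed.SelmerCardCertificateRankZero
import HarnessLib

/-!
# Class O8 (`ClassX4 W p ∧ ¬ Surj W p`): the image-free transplant of Kim's clause (6) is REFUTED by
# `p ∣ #Ш(E/ℚ)` — per certificate, by ONE native `p`-descent line `Sel^{(p)}(E/ℚ) ≠ 0` in rank `0`
# (cell `b2b-bsdres`, lane CLASS-CLOSURE, seat cc-typer-1 = O8 typer of record; team n1011 image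
# strand; sequel of `GaloisImage/SmallImageKuriharaInvariants.lean`)

HONEST FRAMING (run/shared/lean/b2b/bsd-rank1-residual/, verbatim in every file): the goal of the
cell is to DELETE the COMBINATION-SHAPED residual classes of the Birch–Swinnerton-Dyer formula for
ALL analytic-rank `≤ 1` elliptic curves over `ℚ` — "full BSD formula for every rank `≤ 1` curve in
class `C`" assembled STRICTLY from published theorems — so that the rank-`≤ 1` remainder becomes
exactly the CONSTRUCTION-SHAPED classes, which are TYPED (missing-input `Prop`s), NOT attempted.
This is not "finishing BSD". Lane CLASS-CLOSURE: research routes; no claim beyond stated classes;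
census / instrument output = EVIDENCE, never a Literature fact; per-curve certificates are
instrumentation only. THEOREMS ONLY (no definition, no named fact; nothing booked; O8 stays OPEN;
labels unchanged): no-go statements about the cell's OWN typed item `X4.KimShaLengthAt` (p249774,
the binder-free VERBATIM CORE of Kim, Amer. J. Math. 148 (2026) Thm. 1.8 (6)) when its image binder
is dropped at an `irr ∧ ¬surj` pair.

## What this file proves

`GaloisImage/SmallImageKuriharaInvariants.lean` (§§1–3): at `Irr W p ∧ ¬ Surj W p` the cyclic
Kolyvagin level set is `{1}`, `∂^{(∞)}(δ̃) = ∂^{(0)}(δ̃)`, and `X4.KimShaLengthAt W p f` with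
`δ̃_1 ≠ 0` forces `ord_p #Ш(E/ℚ)(p) = 0`. Here:

* §4 REFUTATION SHAPE: `Ш(E/ℚ)` finite, `p ∣ #Ш(E/ℚ)`, `δ̃_1 ≠ 0` ⟹ `¬ X4.KimShaLengthAt W p f`; in
  analytic rank `0` for the newform datum (`δ̃_1 ≠ 0` automatic at odd `p`); and for the
  BSD-currency item `X4.KimShaLengthRankZeroAt`. CERTIFICATE FORM: on a rank-`0` row
  (`rank E(ℚ) = r_an`, `L(E,1) ≠ 0`; `p ∤ #E(ℚ)_tors` by irreducibility) ONE native `p`-descent line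
  `Sel^{(p)}(E/ℚ) ≠ 0` gives `p ∣ #Ш(E/ℚ)` through the tree's PROVED exact sequence
  `0 → E(ℚ)/pE(ℚ) → Sel^{(p)} → Ш[p] → 0` (`Typed.exists_sha_torsion_of_selmerGroup_ne_bot`,
  `Typed.dvd_shaOrder_of_exists_torsion`), hence the refutation — the "glue + one SEL3CT@3
  certificate" cost line of `class-closure/O8/STATEMENT.md` v1 §2.3, realised in the kernel
  (instrument SEL3CT@3 = cc-eng-4; the 22 rank-`0` O8 rows at `p = 3` with `ord₃ #Ш_an = 2`, images
  `3Nn` ×17 / `3Ns` ×5, are its targets; `p = 5`: 6 rows).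
* §5 the O8 corollaries under the class predicate `ClassX4 W p ∧ ¬ Surj W p` (names of
  `O8/STATEMENT.md`), and the VACUITY of the binder-shaped `∂`-exact item
  `Additive.KimRankZeroShaLengthAt W p` (p250103; first binder `Surj W p`): the typed N11 items
  neither cover O8 (binder false) nor are candidates for it (binder-free core says `p ∤ #Ш`).

References: C.-H. Kim, Amer. J. Math. 148 (2026) = arXiv:2203.12159v4, Thm. 1.9 (= journal 1.8) (6),
Thm. 2.1 [Kim2022StructureSelmer]; J.-P. Serre, Invent. Math. 15 (1972) §2.4 Prop. 15 [Serre1972];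
J. H. Silverman, AEC 2nd ed., Thm. X.4.2(a) [SilvermanAEC2009]; cell files class-closure/O8/STATEMENT.md,
cells/n1011/O8-IDEATION.md §A, class-closure/eng-4 (SEL3CT@3 SPEC).
-/

noncomputable section

open scoped Classical MatrixGroups ModularForm

open CongruenceSubgroup WeierstrassCurve Literature.NumberTheory.EllipticCurves
  Literature.NumberTheory.EllipticCurves.ModularForms
  Literature.NumberTheory.EllipticCurves.Rank1Residual
  Literature.NumberTheory.EllipticCurves.Rank1Residual.Typed

namespace Summit.BirchSwinnertonDyer.Rank1Residual.GaloisImage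

/-! ### §4 The refutation shape: `p ∣ #Ш(E/ℚ)` kills the image-free transplant -/

section Refutation

variable (W : WeierstrassCurve ℚ) [W.IsElliptic] [W.IsGloballyMinimal] (p : ℕ) [hp : Fact p.Prime]
  {N : ℕ} (f : CuspForm (Gamma0 N) 2)

/-- **`Ш(E/ℚ)` finite with `p ∣ #Ш(E/ℚ)` and `δ̃_1 ≠ 0` ⟹ `¬ X4.KimShaLengthAt W p f`** at an
`irr ∧ ¬surj` pair. On a rank-`0` O8 row (`E(ℚ)[p] = 0` by irreducibility) the input `p ∣ #Ш` is
delivered by ONE exact `p`-descent, `#Sel^{(p)}(E/ℚ) = p²` (instrument SEL3CT@3, cc-eng-4; the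
22 `p = 3` rows of `O8/STATEMENT.md` §2.3); BSD predicts it on the 28 rows with `ord_p #Ш_an = 2`.
A no-go about a typed item of the cell with its binder dropped; nothing booked.
[cite: Kim2022StructureSelmer, Thm. 1.9 (6) (PDF p. 8)] [cite: Serre1972, §2.4 Prop. 15] -/
theorem not_kimShaLengthAt_of_dvd_shaOrder_of_irr_of_not_surj (hirr : Irr W p) (hns : ¬ Surj W p)
    (h1 : kuriharaDivIndex W p f 1 < ⊤) (hfin : Finite W.sha) (hdvd : p ∣ W.shaOrder) :
    ¬ X4.KimShaLengthAt W p f := fun h6 =>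
  not_dvd_shaOrder_of_kimShaLengthAt_of_irr_of_not_surj W p f hirr hns h6 h1 hfin hdvd

/-- **The same in analytic rank `0` for the newform datum** (`δ̃_1 ≠ 0` automatic, `p` odd):
`L(E,1) ≠ 0`, `Ш` finite, `p ∣ #Ш(E/ℚ)` ⟹ `¬ X4.KimShaLengthAt W p D.f`.
[cite: Kim2022StructureSelmer, Thm. 1.9 (6) (PDF p. 8)] [cite: Serre1972, §2.4 Prop. 15] -/
theorem not_kimShaLengthAt_of_dvd_shaOrder_of_rankZero_of_irr_of_not_surj (hp2 : p ≠ 2)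
    (hirr : Irr W p) (hns : ¬ Surj W p) (hL : W.entireLFunction 1 ≠ 0) (hfin : Finite W.sha)
    (hdvd : p ∣ W.shaOrder) {N : ℕ} [NeZero N] (D : ModularParametrizationData W N) :
    ¬ X4.KimShaLengthAt W p D.f := fun h6 =>
  not_dvd_shaOrder_of_kimShaLengthAt_of_rankZero_of_irr_of_not_surj W p hp2 hirr hns hL hfin D h6
    hdvd

/-- **… and for the BSD-currency item**: `p ∣ #Ш(E/ℚ)` ⟹ `¬ X4.KimShaLengthRankZeroAt W p D.f`
(analytic rank `0`, `p` odd, `Ш` finite, period transfer).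
[cite: Kim2022StructureSelmer, Thm. 1.9 (6) (PDF p. 8)] [cite: Serre1972, §2.4 Prop. 15] -/
theorem not_kimShaLengthRankZeroAt_of_dvd_shaOrder_of_irr_of_not_surj (hp2 : p ≠ 2)
    (hirr : Irr W p) (hns : ¬ Surj W p) (hL : W.entireLFunction 1 ≠ 0) (hfin : Finite W.sha)
    (hdvd : p ∣ W.shaOrder) {N : ℕ} [NeZero N] (D : ModularParametrizationData W N)
    (hper : ∃ u : ℚ, ‖(u : ℚ_[p])‖ = 1 ∧ W.realPeriodRat = u * plusPeriod D.f) :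
    ¬ X4.KimShaLengthRankZeroAt W p D.f := by
  intro h6
  obtain ⟨-, -, -, -, -, hsha⟩ :=
    padicValNat_sha_eq_zero_of_kimShaLengthRankZeroAt_of_irr_of_not_surj W p hp2 hirr hns hL D hper h6
  haveI : Finite W.sha := hfin
  rw [padicValNat_card_addPrimaryComponent (A := W.sha) p] at hsha
  have hpos : 0 < W.shaOrder := W.shaOrder_pos hfin
  rcases padicValNat.eq_zero_iff.mp hsha with h' | h' | h'
  · exact hp.out.one_lt.ne' h'
  · exact hpos.ne' (by unfold WeierstrassCurve.shaOrder; exact h')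
  · exact h' (by unfold WeierstrassCurve.shaOrder at hdvd; exact hdvd)

omit [W.IsGloballyMinimal] in
/-- **The certificate input `p ∣ #Ш(E/ℚ)` from ONE native `p`-descent line on a rank-`0`, `E[p]`
irreducible row**: `Sel^{(p)}(E/ℚ) ≠ 0`, `rank E(ℚ) = r_an = 0` (`L(E,1) ≠ 0`) and `p ∤ #E(ℚ)_tors`
(irreducibility, `padicValNat_torsionOrder_eq_zero_of_irreducible`) give a non-zero class of
`Ш(E/ℚ)[p]` (tree theorem `Typed.exists_sha_torsion_of_selmerGroup_ne_bot`: Mordell–Weil + the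
PROVED exact sequence `0 → E/pE → Sel^{(p)} → Ш[p] → 0`), hence `p ∣ #Ш`
(`Typed.dvd_shaOrder_of_exists_torsion`). Instrument SEL3CT@3 (cc-eng-4) reports `#Sel₃(E) = 9`,
in particular `≠ 0`, on the rows in question. [cite: SilvermanAEC2009, Thm. X.4.2(a)] -/
theorem dvd_shaOrder_of_selmerGroup_ne_bot_of_rankZero_of_irr (hirr : Irr W p)
    (hL : W.entireLFunction 1 ≠ 0) (hmw : W.mordellWeilRank = W.analyticRank)
    (hSel : W.selmerGroup (p : ℤ) ≠ ⊥) : p ∣ W.shaOrder := by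
  have hr0 : W.mordellWeilRank = 0 := by
    rw [hmw, analyticRank_eq_zero_of_entireLFunction_one_ne_zero hL]
  have htors : ¬ p ∣ W.torsionOrder := by
    intro hdvd
    rcases padicValNat.eq_zero_iff.mp (padicValNat_torsionOrder_eq_zero_of_irreducible W p hirr)
      with h | h | h
    · exact hp.out.one_lt.ne' h
    · exact (W.torsionOrder_pos_holds).ne' h
    · exact h hdvd
  exact dvd_shaOrder_of_exists_torsion W p (exists_sha_torsion_of_selmerGroup_ne_bot W p hSel hr0 htors)

/-- **KERNEL REFUTATION OF THE IMAGE-FREE TRANSPLANT, PER CERTIFICATE.** At an `irr ∧ ¬surj` pair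
with `p` odd, `L(E,1) ≠ 0`, `rank E(ℚ) = r_an`, `Ш(E/ℚ)` finite (all theorems in analytic rank `0`:
Gross–Zagier–Kolyvagin, taken as the usual binders), ONE native `p`-descent line
`Sel^{(p)}(E/ℚ) ≠ 0` refutes `X4.KimShaLengthAt W p D.f` for the newform datum `D`. This is the
"glue + one SEL3CT@3 certificate" cost line of `class-closure/O8/STATEMENT.md` v1 §2.3, realised.
Nothing booked; O8 stays OPEN. [cite: Kim2022StructureSelmer, Thm. 1.9 (6) (PDF p. 8)]
[cite: Serre1972, §2.4 Prop. 15] [cite: SilvermanAEC2009, Thm. X.4.2(a)] -/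
theorem not_kimShaLengthAt_of_selmerGroup_ne_bot_of_irr_of_not_surj (hp2 : p ≠ 2)
    (hirr : Irr W p) (hns : ¬ Surj W p) (hL : W.entireLFunction 1 ≠ 0)
    (hmw : W.mordellWeilRank = W.analyticRank) (hfin : Finite W.sha)
    (hSel : W.selmerGroup (p : ℤ) ≠ ⊥) {N : ℕ} [NeZero N] (D : ModularParametrizationData W N) :
    ¬ X4.KimShaLengthAt W p D.f :=
  not_kimShaLengthAt_of_dvd_shaOrder_of_rankZero_of_irr_of_not_surj W p hp2 hirr hns hL hfin
    (dvd_shaOrder_of_selmerGroup_ne_bot_of_rankZero_of_irr W p hirr hL hmw hSel) D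

/-- **… and of the BSD-currency item** `X4.KimShaLengthRankZeroAt W p D.f` (period transfer added).
[cite: Kim2022StructureSelmer, Thm. 1.9 (6) (PDF p. 8)] [cite: SilvermanAEC2009, Thm. X.4.2(a)] -/
theorem not_kimShaLengthRankZeroAt_of_selmerGroup_ne_bot_of_irr_of_not_surj (hp2 : p ≠ 2)
    (hirr : Irr W p) (hns : ¬ Surj W p) (hL : W.entireLFunction 1 ≠ 0)
    (hmw : W.mordellWeilRank = W.analyticRank) (hfin : Finite W.sha)
    (hSel : W.selmerGroup (p : ℤ) ≠ ⊥) {N : ℕ} [NeZero N] (D : ModularParametrizationData W N)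
    (hper : ∃ u : ℚ, ‖(u : ℚ_[p])‖ = 1 ∧ W.realPeriodRat = u * plusPeriod D.f) :
    ¬ X4.KimShaLengthRankZeroAt W p D.f :=
  not_kimShaLengthRankZeroAt_of_dvd_shaOrder_of_irr_of_not_surj W p hp2 hirr hns hL hfin
    (dvd_shaOrder_of_selmerGroup_ne_bot_of_rankZero_of_irr W p hirr hL hmw hSel) D hper

end Refutation

end Summit.BirchSwinnertonDyer.Rank1Residual.GaloisImage

/-! ### §5 Class O8 (`ClassX4 W p ∧ ¬ Surj W p`): corollaries, and the binder-shaped items are vacuous -/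

namespace Summit.BirchSwinnertonDyer.Rank1Residual.Additive.O8

open Summit.BirchSwinnertonDyer.Rank1Residual.GaloisImage

variable (W : WeierstrassCurve ℚ) [W.IsElliptic] [W.IsGloballyMinimal] (p : ℕ) [hp : Fact p.Prime]
  {N : ℕ} (f : CuspForm (Gamma0 N) 2)

/-- **O8: the only cyclic Kolyvagin level is `1`** (`ClassX4 W p` supplies `Irr W p`). The
one-line corollary named in `class-closure/O8/STATEMENT.md` v1 §2.3.
[cite: Serre1972, §2.4 Prop. 15] [cite: Kim2022StructureSelmer, §1.2.2 and Thm. 2.1] -/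
theorem eq_one_of_isCyclicKolyvaginLevel (hX : ClassX4 W p) (hns : ¬ Surj W p) {n : ℕ}
    (hn : IsCyclicKolyvaginLevel W p n) : n = 1 :=
  eq_one_of_isCyclicKolyvaginLevel_of_irr_of_not_surj W p hX.2.2 hns hn

/-- **O8: `∂^{(∞)}(δ̃) = ∂^{(0)}(δ̃) = kuriharaDivIndex W p f 1`.**
[cite: Kim2022StructureSelmer, §1.5.1 (PDF p. 7)] [cite: Serre1972, §2.4 Prop. 15] -/
theorem kuriharaPartialInfty_eq (hX : ClassX4 W p) (hns : ¬ Surj W p) :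
    kuriharaPartialInfty W p f = kuriharaDivIndex W p f 1 :=
  kuriharaPartialInfty_eq_kuriharaDivIndex_one_of_irr_of_not_surj W p f hX.2.2 hns

/-- **O8: the image-free transplant of Kim (6) in analytic rank `0` says `p ∤ #Ш(E/ℚ)`** (`p` odd
is part of `ClassX4`). [cite: Kim2022StructureSelmer, Thm. 1.9 (6) (PDF p. 8)] [cite: Serre1972, §2.4 Prop. 15] -/
theorem not_dvd_shaOrder_of_kimShaLengthAt (hX : ClassX4 W p) (hns : ¬ Surj W p)
    (hL : W.entireLFunction 1 ≠ 0) (hfin : Finite W.sha) {N : ℕ} [NeZero N]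
    (D : ModularParametrizationData W N) (h6 : X4.KimShaLengthAt W p D.f) : ¬ p ∣ W.shaOrder :=
  not_dvd_shaOrder_of_kimShaLengthAt_of_rankZero_of_irr_of_not_surj W p hX.1 hX.2.2 hns hL hfin D h6

/-- **O8: `p ∣ #Ш(E/ℚ)` refutes the transplant** (rank `0`, `Ш` finite).
[cite: Kim2022StructureSelmer, Thm. 1.9 (6) (PDF p. 8)] [cite: Serre1972, §2.4 Prop. 15] -/
theorem not_kimShaLengthAt_of_dvd_shaOrder (hX : ClassX4 W p) (hns : ¬ Surj W p)
    (hL : W.entireLFunction 1 ≠ 0) (hfin : Finite W.sha) (hdvd : p ∣ W.shaOrder) {N : ℕ} [NeZero N]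
    (D : ModularParametrizationData W N) : ¬ X4.KimShaLengthAt W p D.f :=
  not_kimShaLengthAt_of_dvd_shaOrder_of_rankZero_of_irr_of_not_surj W p hX.1 hX.2.2 hns hL hfin hdvd
    D

/-- **O8: ONE native `p`-descent line `Sel^{(p)}(E/ℚ) ≠ 0` on a rank-`0` row refutes the
transplant** (`rank E(ℚ) = r_an`, `Ш` finite — the analytic-rank-`0` theorems as binders). The
22 `p = 3` rows of `O8/STATEMENT.md` §2.3 are SEL3CT@3 targets (`#Sel₃ = 9` expected from `#Ш_an`).
[cite: Kim2022StructureSelmer, Thm. 1.9 (6) (PDF p. 8)] [cite: SilvermanAEC2009, Thm. X.4.2(a)] -/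
theorem not_kimShaLengthAt_of_selmerGroup_ne_bot (hX : ClassX4 W p) (hns : ¬ Surj W p)
    (hL : W.entireLFunction 1 ≠ 0) (hmw : W.mordellWeilRank = W.analyticRank) (hfin : Finite W.sha)
    (hSel : W.selmerGroup (p : ℤ) ≠ ⊥) {N : ℕ} [NeZero N] (D : ModularParametrizationData W N) :
    ¬ X4.KimShaLengthAt W p D.f :=
  not_kimShaLengthAt_of_selmerGroup_ne_bot_of_irr_of_not_surj W p hX.1 hX.2.2 hns hL hmw hfin hSel D

omit [W.IsElliptic] [W.IsGloballyMinimal] hp in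
/-- **O8: the binder-shaped `∂`-exact item is VACUOUS** — `Additive.KimRankZeroShaLengthAt W p`
(cc-typer-1 / n1011-p03 binder shape, first binder `Surj W p`) holds trivially at a non-surjective
pair; so `KimThreeShaLength` / `X4SharpThreeKimShaLength` say nothing on O8, and the binder-free
core `X4.KimShaLengthAt` says the wrong thing (§3). The typed N11 items neither cover nor are
candidates for O8. [cite: Kim2022StructureSelmer, Thm. 1.9 (PDF p. 8), §1.2.5] -/
theorem kimRankZeroShaLengthAt_of_not_surj [W.IsElliptic] [W.IsGloballyMinimal] [Fact p.Prime]
    (hns : ¬ Surj W p) : Additive.KimRankZeroShaLengthAt W p :=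
  fun hs => absurd hs hns

end Summit.BirchSwinnertonDyer.Rank1Residual.Additive.O8

end
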